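import Literature.Probability.Percolation.QuadCrossingRawClosed
import HarnessLib

/-!
# Blaschke selection for finitely many sequences of compact sets (piece (G1-sel) of stub T2b″)

Crux `SAWDevelopingMap.ObservableToSLE` (stmt-CriticalPhenomena-10472), line `six-class-type-ladder`,
stub T2b″ `stub_carvedReduction_squeezeSolid`.  Landing target:
`Summits/CriticalPhenomena/SAWScalingLimit/Theorems/SAWDevelopingMapObservableToSLETypeLadderCarvedReductionSqueezeSelect.lean`
(`--supports stmt-CriticalPhenomena-10472`).

Item (G1) of the repaired squeeze (SELECTION): along a sequence of pinned carved domains, each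
described by FINITELY many nonempty compact sets in a fixed disc (the `≤ 2N` rescaled level hexagons,
the `2N` spine hexagons through their centres, the fat bodies, the spines, and the singletons of the
rescaled roots and gates), one passes to a subsequence along which ALL of them converge in the
Hausdorff metric.  This is Blaschke's selection theorem in the product of finitely many copies of the
hyperspace `NonemptyCompacts ℂ` (Vietoris = Hausdorff topology; the nonempty compact subsets of a
compact set form a compact set, `NonemptyCompacts.isCompact_subsets_of_isCompact`, and a finite
product of compact sets is compact):

* `exists_subseq_tendsto_nonemptyCompacts_pi` — the selection, with the limits again inside the disc;
* `tendsto_hausdorffDist_of_tendsto` — coordinatewise, `hausdorffDist (F (ψ n) i) (L i) → 0`, the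
  form consumed by the Hausdorff-limit lemmas of `Literature.Probability.Percolation.QuadCrossing`
  (`exists_seq_mem_tendsto_of_hausdorffDist_tendsto`, `mem_of_tendsto_of_hausdorffDist_tendsto`,
  `isPreconnected_of_hausdorffDist_tendsto`).

Registered: `stub_carvedReduction_blaschkeSelection`.
Sources: W. Blaschke, Kreis und Kugel (1916) §18; Ch. Pommerenke, Boundary Behaviour of Conformal
Maps (1992) §1.4.
-/

noncomputable section

open Set Filter Metric TopologicalSpace
open scoped Topology

namespace Summit.CriticalPhenomena.SAWScalingLimit.Theorems.ObservableToSLE.TypeLadder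

/-- **Blaschke selection for finitely many sequences.**  If `F n i` (`i` in a finite index type)
are nonempty compact subsets of a compact set `K ⊆ ℂ`, there are a subsequence `ψ` and nonempty
compact sets `L i ⊆ K` with `F (ψ n) → L` in the product of the Hausdorff hyperspaces. -/
theorem exists_subseq_tendsto_nonemptyCompacts_pi {ι : Type*} [Finite ι] {K : Set ℂ}
    (hK : IsCompact K) (F : ℕ → ι → NonemptyCompacts ℂ) (hF : ∀ n i, ((F n i : Set ℂ)) ⊆ K) :
    ∃ (ψ : ℕ → ℕ) (L : ι → NonemptyCompacts ℂ), StrictMono ψ ∧ (∀ i, ((L i : Set ℂ)) ⊆ K) ∧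
      Tendsto (fun n => F (ψ n)) atTop (𝓝 L) := by
  set C : Set (ι → NonemptyCompacts ℂ) := Set.pi univ fun _ => {S : NonemptyCompacts ℂ | (S : Set ℂ) ⊆ K}
    with hC
  have hCc : IsCompact C := isCompact_univ_pi fun _ => NonemptyCompacts.isCompact_subsets_of_isCompact hK
  have hmem : ∀ n, F n ∈ C := fun n => fun i _ => hF n i
  obtain ⟨L, hL, ψ, hψ, hlim⟩ := hCc.tendsto_subseq hmem
  exact ⟨ψ, L, hψ, fun i => hL i (mem_univ _), hlim⟩

/-- Coordinatewise form: along the selected subsequence each coordinate converges in the Hausdorff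
METRIC, `hausdorffDist (F (ψ n) i) (L i) → 0`. -/
theorem tendsto_hausdorffDist_of_tendsto {ι : Type*} {F : ℕ → ι → NonemptyCompacts ℂ}
    {L : ι → NonemptyCompacts ℂ} (h : Tendsto F atTop (𝓝 L)) (i : ι) :
    Tendsto (fun n => hausdorffDist ((F n i : Set ℂ)) ((L i : Set ℂ))) atTop (𝓝 0) := by
  have hi : Tendsto (fun n => F n i) atTop (𝓝 (L i)) := (continuous_apply i).continuousAt.tendsto.comp h
  rw [tendsto_iff_dist_tendsto_zero] at hi
  refine hi.congr fun n => ?_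
  rw [NonemptyCompacts.dist_eq]

/-- The Hausdorff edistance between nonempty compact sets is finite (so the metric lemmas apply). -/
theorem hausdorffEDist_ne_top_nonemptyCompacts (A B : NonemptyCompacts ℂ) :
    Metric.hausdorffEDist ((A : Set ℂ)) ((B : Set ℂ)) ≠ ⊤ :=
  hausdorffEDist_ne_top_of_nonempty_of_bounded A.nonempty B.nonempty A.isCompact.isBounded
    B.isCompact.isBounded

/-- **Registered sub-goal `stub_carvedReduction_blaschkeSelection`** (crux item
stmt-CriticalPhenomena-10472, stub T2b″ `stub_carvedReduction_squeezeSolid`, piece (G1-sel) BLASCHKE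
SELECTION FOR FINITELY MANY SEQUENCES, Hausdorff-metric form on `Fin N`). -/
theorem stub_carvedReduction_blaschkeSelection :
    ∀ (N : ℕ) (K : Set ℂ) (F : ℕ → Fin N → NonemptyCompacts ℂ), IsCompact K →
      (∀ n i, ((F n i : Set ℂ)) ⊆ K) →
      ∃ (ψ : ℕ → ℕ) (L : Fin N → NonemptyCompacts ℂ), StrictMono ψ ∧ (∀ i, ((L i : Set ℂ)) ⊆ K) ∧
        ∀ i, Tendsto (fun n => hausdorffDist ((F (ψ n) i : Set ℂ)) ((L i : Set ℂ))) atTop (𝓝 0) := by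
  intro N K F hK hF
  obtain ⟨ψ, L, hψ, hL, hlim⟩ := exists_subseq_tendsto_nonemptyCompacts_pi hK F hF
  exact ⟨ψ, L, hψ, hL, fun i => tendsto_hausdorffDist_of_tendsto hlim i⟩

end Summit.CriticalPhenomena.SAWScalingLimit.Theorems.ObservableToSLE.TypeLadder

end
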